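import Literature.Geometry.Lorentzian.RiemannianMeasureDensity
import Literature.Geometry.Lorentzian.InverseMeanCurvatureFlowArea
import Literature.Geometry.Lorentzian.GreenIdentity
import HarnessLib

/-!
# The canonical volume density ratio `θ = dμ_{h₁}/dμ_{h₂}` of two Riemannian metrics

Topic `Literature/Geometry/Lorentzian` (companion of `RiemannianMeasureDensity.lean`, which proves
`μ_{h₁} = ρ · μ_{h₂}` for any `ρ` satisfying the chart identities). Here the density is
CONSTRUCTED: for two `C^n` Riemannian metrics `h₁, h₂` on a manifold `N` modelled on `ℝ^m`,

  `θ(w) = √det (h₁)ᵢⱼ / √det (h₂)ᵢⱼ`   (metric coefficients `chartGramMatrix` of `Volume.lean`,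
                                          read in the chart centred at `w`)

does not depend on the frame (`sqrt_det_gram_div_eq_of_basis`: both Gram matrices transform by
`Pᵀ G P`; `sqrt_det_gram_localFrame_div_eq`; `sqrt_det_chartGramMatrix_div_eq` — in ANY chart the
ratio of the chart densities is `θ ∘ φ⁻¹`), is positive and continuous
(`sqrt_det_chartGramMatrix_div_pos`, `continuous_sqrt_det_chartGramMatrix_div`), and on a compact
manifold

* `riemannianMeasure_eq_withDensity_sqrt_det_div` — **`μ_{h₁} = θ · μ_{h₂}`**;
* `integral_riemannianMeasure_eq_integral_mul` — `∫ f dμ_{h₁} = ∫ θ f dμ_{h₂}`.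

This is the form in which a volume ∫ is differentiated along a one-parameter family of metrics
(Topping 2006, Prop. 2.3.12, `∂ₜ dV = ½ tr(∂ₜ g) dV`; for mean curvature flow `∂ₜ dμ = -H² dμ`,
`MCFMetricEvolution.lean`). Everything is PROVED; no definitions, no named facts.

## References

* I. Chavel, *Riemannian Geometry: A Modern Introduction*, 2nd ed., CUP 2006, §III.3,
  (III.3.5)–(III.3.6). [Chavel2006]
* P. Topping, *Lectures on the Ricci flow*, CUP 2006, Prop. 2.3.12 (p. 25). [Topping2006]
-/

noncomputable section

open Manifold Bundle MeasureTheory Set Filter Function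
open scoped ContDiff Topology ENNReal Matrix

namespace Literature.Geometry.Lorentzian

open PseudoRiemannianMetric

variable {H : Type*} [TopologicalSpace H] {n : ℕ∞ω} {m : ℕ}
  {I : ModelWithCorners ℝ (EuclideanSpace ℝ (Fin m)) H}
  {N : Type*} [TopologicalSpace N] [ChartedSpace H N] [IsManifold I ∞ N]
  (h₁ h₂ : ContMDiffRiemannianMetric I n (EuclideanSpace ℝ (Fin m)) (TangentSpace I : N → Type _))

/-! ### The ratio of the volume densities of two metrics does not depend on the frame -/

/-- **Change of frame for Gram determinants**: for two bases `b, b'` of a real vector space and two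
bilinear forms `B₁, B₂` with `B₂` symmetric positive definite,
`√det (B₁(bᵢ, bⱼ)) / √det (B₂(bᵢ, bⱼ)) = √det (B₁(b'ᵢ, b'ⱼ)) / √det (B₂(b'ᵢ, b'ⱼ))`
(both Gram matrices transform by `P ↦ Pᵀ G P` with the same change-of-basis matrix `P`).
[folklore] -/
theorem sqrt_det_gram_div_eq_of_basis {V : Type*} [AddCommGroup V] [Module ℝ V] {ι : Type*}
    [Fintype ι] [DecidableEq ι] (b b' : Module.Basis ι ℝ V) (B₁ B₂ : LinearMap.BilinForm ℝ V)
    (h1symm : ∀ v w, B₁ v w = B₁ w v) (h1pos : ∀ v, v ≠ 0 → 0 < B₁ v v)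
    (h2symm : ∀ v w, B₂ v w = B₂ w v) (h2pos : ∀ v, v ≠ 0 → 0 < B₂ v v) :
    Real.sqrt (Matrix.of fun i j ↦ B₁ (b i) (b j)).det /
        Real.sqrt (Matrix.of fun i j ↦ B₂ (b i) (b j)).det =
      Real.sqrt (Matrix.of fun i j ↦ B₁ (b' i) (b' j)).det /
        Real.sqrt (Matrix.of fun i j ↦ B₂ (b' i) (b' j)).det := by
  set P : Matrix ι ι ℝ := Matrix.of fun k i ↦ b'.repr (b i) k with hP
  have hG1 := gram_eq_transpose_mul_mul b' B₁ b
  have hG2 := gram_eq_transpose_mul_mul b' B₂ b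
  have hd1 : (Matrix.of fun i j ↦ B₁ (b i) (b j)).det =
      P.det ^ 2 * (Matrix.of fun i j ↦ B₁ (b' i) (b' j)).det := by
    rw [hG1, Matrix.det_mul, Matrix.det_mul, Matrix.det_transpose]; ring
  have hd2 : (Matrix.of fun i j ↦ B₂ (b i) (b j)).det =
      P.det ^ 2 * (Matrix.of fun i j ↦ B₂ (b' i) (b' j)).det := by
    rw [hG2, Matrix.det_mul, Matrix.det_mul, Matrix.det_transpose]; ring
  have hD1 : 0 < (Matrix.of fun i j ↦ B₁ (b' i) (b' j)).det := det_gram_pos b' B₁ h1symm h1pos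
  have hD2 : 0 < (Matrix.of fun i j ↦ B₂ (b' i) (b' j)).det := det_gram_pos b' B₂ h2symm h2pos
  have hDb : 0 < (Matrix.of fun i j ↦ B₂ (b i) (b j)).det := det_gram_pos b B₂ h2symm h2pos
  have hPne : P.det ≠ 0 := by
    intro h0
    rw [hd2, h0] at hDb
    simp at hDb
  rw [hd1, hd2, Real.sqrt_mul (sq_nonneg _), Real.sqrt_mul (sq_nonneg _), Real.sqrt_sq_eq_abs,
    mul_div_mul_left _ _ (abs_ne_zero.2 hPne)]

/-- The Gram matrix of the local frame of the trivialisation at `x`, read at a point `w` of its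
base set, for a `C^n` Riemannian metric `h`: `(h_w(∂ᵢ, ∂ⱼ))`. The metric coefficients of
`Volume.lean` are these: `chartGramMatrix h x y = (h(∂ᵢ, ∂ⱼ))(φ⁻¹ y)`
(`chartGramMatrix_apply_eq_val_localFrame`). [folklore] -/
theorem chartGramMatrix_eq_gram_localFrame (x : N) {y : EuclideanSpace ℝ (Fin m)}
    (hy : y ∈ (extChartAt I x).target) :
    chartGramMatrix h₁ x y = Matrix.of fun i j ↦ (ofRiemannian h₁).val ((extChartAt I x).symm y)
      ((trivializationAt (EuclideanSpace ℝ (Fin m)) (TangentSpace I) x).localFrame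
        (EuclideanSpace.basisFun (Fin m) ℝ).toBasis i ((extChartAt I x).symm y))
      ((trivializationAt (EuclideanSpace ℝ (Fin m)) (TangentSpace I) x).localFrame
        (EuclideanSpace.basisFun (Fin m) ℝ).toBasis j ((extChartAt I x).symm y)) := by
  ext i j
  rw [Matrix.of_apply]
  exact chartGramMatrix_apply_eq_val_localFrame h₁ x hy i j

/-- **Frame independence of the density ratio**: at a point `w` in the base sets of the
trivialisations at `x` and at `x'`, the ratio `√det (h₁(∂ᵢ, ∂ⱼ)) / √det (h₂(∂ᵢ, ∂ⱼ))` is the same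
for the two coordinate frames. [cite: Chavel2006, §III.3 (III.3.5)–(III.3.6)] -/
theorem sqrt_det_gram_localFrame_div_eq (x x' : N) {w : N}
    (hw : w ∈ (trivializationAt (EuclideanSpace ℝ (Fin m)) (TangentSpace I) x).baseSet)
    (hw' : w ∈ (trivializationAt (EuclideanSpace ℝ (Fin m)) (TangentSpace I) x').baseSet) :
    Real.sqrt (Matrix.of fun i j ↦ (ofRiemannian h₁).val w
        ((trivializationAt (EuclideanSpace ℝ (Fin m)) (TangentSpace I) x).localFrame
          (EuclideanSpace.basisFun (Fin m) ℝ).toBasis i w)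
        ((trivializationAt (EuclideanSpace ℝ (Fin m)) (TangentSpace I) x).localFrame
          (EuclideanSpace.basisFun (Fin m) ℝ).toBasis j w)).det /
      Real.sqrt (Matrix.of fun i j ↦ (ofRiemannian h₂).val w
        ((trivializationAt (EuclideanSpace ℝ (Fin m)) (TangentSpace I) x).localFrame
          (EuclideanSpace.basisFun (Fin m) ℝ).toBasis i w)
        ((trivializationAt (EuclideanSpace ℝ (Fin m)) (TangentSpace I) x).localFrame
          (EuclideanSpace.basisFun (Fin m) ℝ).toBasis j w)).det =
    Real.sqrt (Matrix.of fun i j ↦ (ofRiemannian h₁).val w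
        ((trivializationAt (EuclideanSpace ℝ (Fin m)) (TangentSpace I) x').localFrame
          (EuclideanSpace.basisFun (Fin m) ℝ).toBasis i w)
        ((trivializationAt (EuclideanSpace ℝ (Fin m)) (TangentSpace I) x').localFrame
          (EuclideanSpace.basisFun (Fin m) ℝ).toBasis j w)).det /
      Real.sqrt (Matrix.of fun i j ↦ (ofRiemannian h₂).val w
        ((trivializationAt (EuclideanSpace ℝ (Fin m)) (TangentSpace I) x').localFrame
          (EuclideanSpace.basisFun (Fin m) ℝ).toBasis i w)
        ((trivializationAt (EuclideanSpace ℝ (Fin m)) (TangentSpace I) x').localFrame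
          (EuclideanSpace.basisFun (Fin m) ℝ).toBasis j w)).det := by
  classical
  have hLF : ∀ i, (trivializationAt (EuclideanSpace ℝ (Fin m)) (TangentSpace I) x).localFrame
      (EuclideanSpace.basisFun (Fin m) ℝ).toBasis i w =
      (trivializationAt (EuclideanSpace ℝ (Fin m)) (TangentSpace I) x).basisAt
        (EuclideanSpace.basisFun (Fin m) ℝ).toBasis hw i :=
    fun i ↦ Trivialization.localFrame_apply_of_mem_baseSet _ _ hw
  have hLF' : ∀ i, (trivializationAt (EuclideanSpace ℝ (Fin m)) (TangentSpace I) x').localFrame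
      (EuclideanSpace.basisFun (Fin m) ℝ).toBasis i w =
      (trivializationAt (EuclideanSpace ℝ (Fin m)) (TangentSpace I) x').basisAt
        (EuclideanSpace.basisFun (Fin m) ℝ).toBasis hw' i :=
    fun i ↦ Trivialization.localFrame_apply_of_mem_baseSet _ _ hw'
  set b := (trivializationAt (EuclideanSpace ℝ (Fin m)) (TangentSpace I) x).basisAt
    (EuclideanSpace.basisFun (Fin m) ℝ).toBasis hw with hb
  set b' := (trivializationAt (EuclideanSpace ℝ (Fin m)) (TangentSpace I) x').basisAt
    (EuclideanSpace.basisFun (Fin m) ℝ).toBasis hw' with hb'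
  have hM : ∀ (g : PseudoRiemannianMetric I n (EuclideanSpace ℝ (Fin m)) (TangentSpace I : N → Type _)),
      (Matrix.of fun i j ↦ g.val w
        ((trivializationAt (EuclideanSpace ℝ (Fin m)) (TangentSpace I) x).localFrame
          (EuclideanSpace.basisFun (Fin m) ℝ).toBasis i w)
        ((trivializationAt (EuclideanSpace ℝ (Fin m)) (TangentSpace I) x).localFrame
          (EuclideanSpace.basisFun (Fin m) ℝ).toBasis j w)) =
      Matrix.of fun i j ↦ (g.toBilinForm w) (b i) (b j) := fun g ↦ by
    ext i j
    rw [Matrix.of_apply, Matrix.of_apply, hLF i, hLF j, toBilinForm_apply]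
  have hM' : ∀ (g : PseudoRiemannianMetric I n (EuclideanSpace ℝ (Fin m)) (TangentSpace I : N → Type _)),
      (Matrix.of fun i j ↦ g.val w
        ((trivializationAt (EuclideanSpace ℝ (Fin m)) (TangentSpace I) x').localFrame
          (EuclideanSpace.basisFun (Fin m) ℝ).toBasis i w)
        ((trivializationAt (EuclideanSpace ℝ (Fin m)) (TangentSpace I) x').localFrame
          (EuclideanSpace.basisFun (Fin m) ℝ).toBasis j w)) =
      Matrix.of fun i j ↦ (g.toBilinForm w) (b' i) (b' j) := fun g ↦ by
    ext i j
    rw [Matrix.of_apply, Matrix.of_apply, hLF' i, hLF' j, toBilinForm_apply]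
  rw [hM, hM, hM', hM']
  exact sqrt_det_gram_div_eq_of_basis b b' ((ofRiemannian h₁).toBilinForm w)
    ((ofRiemannian h₂).toBilinForm w)
    (fun v u ↦ by rw [toBilinForm_apply, toBilinForm_apply]; exact (ofRiemannian h₁).symm w v u)
    (fun v hv ↦ by rw [toBilinForm_apply]; exact h₁.pos w v hv)
    (fun v u ↦ by rw [toBilinForm_apply, toBilinForm_apply]; exact (ofRiemannian h₂).symm w v u)
    (fun v hv ↦ by rw [toBilinForm_apply]; exact h₂.pos w v hv)


/-! ### The canonical density ratio `θ = dμ_{h₁}/dμ_{h₂}` -/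

/-- **The density ratio read in any chart**: for `y` in the target of the extended chart at `x`,
`√det (h₁)ᵢⱼ(y) / √det (h₂)ᵢⱼ(y) = θ(φ⁻¹ y)` where
`θ(w) = √det (h₁)ᵢⱼ / √det (h₂)ᵢⱼ` is computed in the chart centred at `w` itself — the ratio of
the volume densities is a function on the manifold. [cite: Chavel2006, §III.3 (III.3.5)–(III.3.6)] -/
theorem sqrt_det_chartGramMatrix_div_eq (x : N) {y : EuclideanSpace ℝ (Fin m)}
    (hy : y ∈ (extChartAt I x).target) :
    Real.sqrt (chartGramMatrix h₁ x y).det / Real.sqrt (chartGramMatrix h₂ x y).det =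
      Real.sqrt (chartGramMatrix h₁ ((extChartAt I x).symm y)
          (extChartAt I ((extChartAt I x).symm y) ((extChartAt I x).symm y))).det /
        Real.sqrt (chartGramMatrix h₂ ((extChartAt I x).symm y)
          (extChartAt I ((extChartAt I x).symm y) ((extChartAt I x).symm y))).det := by
  set w := (extChartAt I x).symm y with hw
  have hwx : w ∈ (trivializationAt (EuclideanSpace ℝ (Fin m)) (TangentSpace I) x).baseSet := by
    rw [TangentBundle.trivializationAt_baseSet, ← extChartAt_source I]
    exact (extChartAt I x).map_target hy
  have hww : w ∈ (trivializationAt (EuclideanSpace ℝ (Fin m)) (TangentSpace I) w).baseSet := by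
    rw [TangentBundle.trivializationAt_baseSet]; exact mem_chart_source H w
  have hy' : extChartAt I w w ∈ (extChartAt I w).target := mem_extChartAt_target w
  rw [chartGramMatrix_eq_gram_localFrame h₁ x hy, chartGramMatrix_eq_gram_localFrame h₂ x hy,
    chartGramMatrix_eq_gram_localFrame h₁ w hy', chartGramMatrix_eq_gram_localFrame h₂ w hy',
    extChartAt_to_inv (I := I) w]
  exact sqrt_det_gram_localFrame_div_eq h₁ h₂ x w hwx hww

/-- **The density ratio is positive.** [folklore] -/
theorem sqrt_det_chartGramMatrix_div_pos (w : N) :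
    0 < Real.sqrt (chartGramMatrix h₁ w (extChartAt I w w)).det /
      Real.sqrt (chartGramMatrix h₂ w (extChartAt I w w)).det :=
  div_pos (sqrt_det_chartGramMatrix_pos h₁ w (mem_extChartAt_target w))
    (sqrt_det_chartGramMatrix_pos h₂ w (mem_extChartAt_target w))

/-- **The density ratio is continuous** (in the chart at `z` it is the quotient of the two
continuous, positive chart densities). [folklore] -/
theorem continuous_sqrt_det_chartGramMatrix_div :
    Continuous fun w : N ↦ Real.sqrt (chartGramMatrix h₁ w (extChartAt I w w)).det /
      Real.sqrt (chartGramMatrix h₂ w (extChartAt I w w)).det := by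
  refine continuous_iff_continuousAt.2 fun z ↦ ?_
  have hS : (extChartAt I z).source ∈ 𝓝 z := (isOpen_extChartAt_source z).mem_nhds
    (mem_extChartAt_source z)
  -- on the chart source at `z` the ratio is read in the chart at `z`
  have heq : (fun w : N ↦ Real.sqrt (chartGramMatrix h₁ w (extChartAt I w w)).det /
      Real.sqrt (chartGramMatrix h₂ w (extChartAt I w w)).det) =ᶠ[𝓝 z]
      fun w ↦ Real.sqrt (chartGramMatrix h₁ z (extChartAt I z w)).det /
        Real.sqrt (chartGramMatrix h₂ z (extChartAt I z w)).det := by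
    filter_upwards [hS] with w hw
    have h := sqrt_det_chartGramMatrix_div_eq h₁ h₂ z ((extChartAt I z).map_source hw)
    rw [(extChartAt I z).left_inv hw] at h
    exact h.symm
  refine (ContinuousAt.congr ?_ heq.symm)
  have hc : ContinuousOn (fun w ↦ Real.sqrt (chartGramMatrix h₁ z (extChartAt I z w)).det /
      Real.sqrt (chartGramMatrix h₂ z (extChartAt I z w)).det) (extChartAt I z).source := by
    refine ContinuousOn.div ?_ ?_ fun w hw ↦ ?_
    · exact (continuousOn_sqrt_det_chartGramMatrix h₁ z).comp (continuousOn_extChartAt z)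
        fun w hw ↦ (extChartAt I z).map_source hw
    · exact (continuousOn_sqrt_det_chartGramMatrix h₂ z).comp (continuousOn_extChartAt z)
        fun w hw ↦ (extChartAt I z).map_source hw
    · exact (sqrt_det_chartGramMatrix_pos h₂ z ((extChartAt I z).map_source hw)).ne'
  exact hc.continuousAt hS

variable [T3Space N] [MeasurableSpace N] [BorelSpace N] [CompactSpace N]

/-- **`dμ_{h₁} = θ dμ_{h₂}` with the canonical density** `θ = √(det h₁ / det h₂)` (read in any
chart): the Riemannian measures of two `C^n` Riemannian metrics on a compact manifold differ by
the continuous positive density `θ`. [cite: Chavel2006, §III.3 (III.3.5)–(III.3.6)]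
[cite: Topping2006, Prop. 2.3.12 (p. 25)] -/
theorem riemannianMeasure_eq_withDensity_sqrt_det_div :
    riemannianMeasure h₁ = (riemannianMeasure h₂).withDensity fun w ↦ ENNReal.ofReal
      (Real.sqrt (chartGramMatrix h₁ w (extChartAt I w w)).det /
        Real.sqrt (chartGramMatrix h₂ w (extChartAt I w w)).det) := by
  refine riemannianMeasure_eq_withDensity_ofReal_of_chartGram h₁ h₂
    (continuous_sqrt_det_chartGramMatrix_div h₁ h₂).measurable
    (fun w ↦ (sqrt_det_chartGramMatrix_div_pos h₁ h₂ w).le) fun x y hy ↦ ?_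
  rw [← sqrt_det_chartGramMatrix_div_eq h₁ h₂ x hy,
    div_mul_cancel₀ _ (sqrt_det_chartGramMatrix_pos h₂ x hy).ne']

/-- **Integration against `μ_{h₁}` is integration of `θ ·` against `μ_{h₂}`.**
[cite: Chavel2006, §III.3 (III.3.5)–(III.3.6)] -/
theorem integral_riemannianMeasure_eq_integral_mul {E : Type*} [NormedAddCommGroup E]
    [NormedSpace ℝ E] (f : N → E) :
    ∫ w, f w ∂riemannianMeasure h₁ =
      ∫ w, (Real.sqrt (chartGramMatrix h₁ w (extChartAt I w w)).det /
        Real.sqrt (chartGramMatrix h₂ w (extChartAt I w w)).det) • f w ∂riemannianMeasure h₂ := by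
  have hmeas := (continuous_sqrt_det_chartGramMatrix_div h₁ h₂).measurable
  rw [riemannianMeasure_eq_withDensity_sqrt_det_div h₁ h₂]
  have h := integral_withDensity_eq_integral_smul (μ := riemannianMeasure h₂)
    (f := fun w ↦ (Real.sqrt (chartGramMatrix h₁ w (extChartAt I w w)).det /
        Real.sqrt (chartGramMatrix h₂ w (extChartAt I w w)).det).toNNReal)
    (hmeas.real_toNNReal) f
  refine (h.trans ?_)
  refine integral_congr_ae (Eventually.of_forall fun w ↦ ?_)
  simp only [NNReal.smul_def, Real.coe_toNNReal _ (sqrt_det_chartGramMatrix_div_pos h₁ h₂ w).le]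

end Literature.Geometry.Lorentzian

end
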